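/- LEAD seat `ym-line-cbag-p1` (prover-ym-line-cbag-p1-g24-0), route `EguchiKawaiDirectionLadder` (ideator ym-idea-2, LINE 8),
crux K_A `TripleSmallBallMargin` (stmt-QuantumFields-27724), S10-B of the LEAD's v7 architecture (ARCH-27724-lead-g24 §3(ii)–(iii),
F3/F4 of the assembly contract): the BLOCK-LOCAL FIBRE BOUND — inside one decoupled block (index type `α`), the Haar-pair measure
of the block-local event «both absorbed compressions are entrywise rigid against the block's phases AND their commutator is small
modulo low rank» is at most `min{ρ₁·ρ₂, ψ}` where `ρ_μ` is the rank-robust RIGIDITY measure of one Haar unitary (LEAD's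
`…RigidityTransfer`) and `ψ` the rank-robust PAIR measure (w4's pair transfer, here with the LINEAR junk bound under `‖S_μ‖_op ≤ 1`,
F3).  Index-generic; the Fin-`n_c` small-ball inputs (E_rob p644373, Ψ_rob p644252) plug in after w5's Haar transport.
ROUTE-INDEPENDENT.  Nothing here bears on the Yang–Mills mass gap (barrier-ledger line onto `EguchiKawaiBreakdown`). -/
import Summits.QuantumFields.YangMills.Theorems.EguchiKawaiDirectionLadderRigidityTransfer
import HarnessLib

/-!
# Route `EguchiKawaiDirectionLadder`, crux `TripleSmallBallMargin`: the block-local fibre bound (S10-B)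

For `M_μ = Θ_μ + R_μ + S_μ` (`Θ_μ ∈ U(α)`, `rank R_μ ≤ q_μ`, `Σ|S_μ|² ≤ e_μ`, `‖S_μ‖_op ≤ 1`), phases `d : α → ℂ` (`|d_i| ≤ 1`),
and Haar-independent `V₁, V₂ ∈ U(α)`:

* `sum_norm_sq_transfer_S_le_linear` — the junk `S′` of w4's `commutator_transfer_identity` has `Σ|S′|² ≤ 18(e₁ + e₂)` (LINEAR; the
  cross terms `S₁V₁S₂V₂` are bounded through `‖S₂V₂‖_op ≤ 1`, not through `Σ|S₂|²`);
* `haar_prod_robustPairEvent_transfer_linear` — w4's pair transfer with the linear junk: rank slack `k + 2(q₁+q₂)`, budget `2s + 36(e₁+e₂)`;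
* `blockPairFibre_le_min` — `Haar²{(V₁,V₂) : RIG(M₁V₁) ≤ s₁ ∧ RIG(M₂V₂) ≤ s₁ ∧ ∃L rk ≤ k, Σ|(M₁V₁M₂V₂ − M₂V₂M₁V₁ − L)|² ≤ s}`
  `≤ min{ Haar{RIGrob(2s₁+8e₁, 2q₁)} · Haar{RIGrob(2s₁+8e₂, 2q₂)} , Haar²{COMMrob(2s+36(e₁+e₂), k+2(q₁+q₂))} }`.
-/

set_option autoImplicit false

noncomputable section

open MeasureTheory
open scoped Matrix ENNReal Matrix.Norms.L2Operator
open Literature.Barriers.QuantumFields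

namespace Summit.QuantumFields.YangMills.Theorems.EguchiKawaiDirectionLadder

variable {α : Type} [Fintype α] [DecidableEq α]

local notation "haarα" => Literature.MathematicalPhysics.QuantumFieldTheory.haarProbability (Matrix.unitaryGroup α ℂ)

/-- A product `A·B` with `‖B‖_op ≤ 1` has `Σ|(AB)_{ij}|² ≤ Σ|A_{ij}|²`. -/
theorem sum_norm_sq_mul_le_of_opNorm_le_one (A B : Matrix α α ℂ) (hB : ‖B‖ ≤ 1) :
    ∑ i, ∑ j, ‖(A * B) i j‖ ^ 2 ≤ ∑ i, ∑ j, ‖A i j‖ ^ 2 := by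
  have h := sum_norm_sq_mul_le' B A
  have h0 : 0 ≤ ∑ i, ∑ j, ‖A i j‖ ^ 2 := Finset.sum_nonneg fun _ _ => Finset.sum_nonneg fun _ _ => by positivity
  have hB2 : ‖B‖ ^ 2 ≤ 1 := by have := norm_nonneg B; nlinarith
  calc ∑ i, ∑ j, ‖(A * B) i j‖ ^ 2 ≤ ‖B‖ ^ 2 * ∑ i, ∑ j, ‖A i j‖ ^ 2 := h
    _ ≤ 1 * ∑ i, ∑ j, ‖A i j‖ ^ 2 := by gcongr
    _ = _ := one_mul _

/-- The operator norm of `S·V` (`V` unitary) is `≤ ‖S‖`. -/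
theorem opNorm_mul_unitary_le (S : Matrix α α ℂ) (V : Matrix.unitaryGroup α ℂ) : ‖S * (V : Matrix α α ℂ)‖ ≤ ‖S‖ := by
  letI : CStarAlgebra (Matrix α α ℂ) := {}
  rw [CStarRing.norm_mul_coe_unitary S ⟨(V : Matrix α α ℂ), V.2⟩]

/-- **Linear junk bound.**  With `‖S₁‖_op, ‖S₂‖_op ≤ 1`: `Σ|S′|² ≤ 18(e₁ + e₂)` for the `S′` of `commutator_transfer_identity`. -/
theorem sum_norm_sq_transfer_S_le_linear (Θ₁ U₁ Θ₂ U₂ : Matrix.unitaryGroup α ℂ) (S₁ S₂ : Matrix α α ℂ) {e₁ e₂ : ℝ}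
    (h₁ : ∑ i, ∑ j, ‖S₁ i j‖ ^ 2 ≤ e₁) (h₂ : ∑ i, ∑ j, ‖S₂ i j‖ ^ 2 ≤ e₂) (hS₁ : ‖S₁‖ ≤ 1) (hS₂ : ‖S₂‖ ≤ 1) :
    ∑ i, ∑ j, ‖(((Θ₁ : Matrix α α ℂ) * (U₁ : Matrix α α ℂ) * (S₂ * (U₂ : Matrix α α ℂ)) +
          S₁ * (U₁ : Matrix α α ℂ) * ((Θ₂ : Matrix α α ℂ) * (U₂ : Matrix α α ℂ)) +
          S₁ * (U₁ : Matrix α α ℂ) * (S₂ * (U₂ : Matrix α α ℂ))) -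
        ((Θ₂ : Matrix α α ℂ) * (U₂ : Matrix α α ℂ) * (S₁ * (U₁ : Matrix α α ℂ)) +
          S₂ * (U₂ : Matrix α α ℂ) * ((Θ₁ : Matrix α α ℂ) * (U₁ : Matrix α α ℂ)) +
          S₂ * (U₂ : Matrix α α ℂ) * (S₁ * (U₁ : Matrix α α ℂ)))) i j‖ ^ 2 ≤
      18 * (e₁ + e₂) := by
  set V₁ : Matrix α α ℂ := (U₁ : Matrix α α ℂ) with hV₁
  set V₂ : Matrix α α ℂ := (U₂ : Matrix α α ℂ) with hV₂
  have hop₁ : ‖S₁ * V₁‖ ≤ 1 := (opNorm_mul_unitary_le S₁ U₁).trans hS₁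
  have hop₂ : ‖S₂ * V₂‖ ≤ 1 := (opNorm_mul_unitary_le S₂ U₂).trans hS₂
  have hm₁ : ∑ i, ∑ j, ‖(S₁ * V₁) i j‖ ^ 2 ≤ e₁ := by rw [hV₁, sum_norm_sq_mul_unitary]; exact h₁
  have hm₂ : ∑ i, ∑ j, ‖(S₂ * V₂) i j‖ ^ 2 ≤ e₂ := by rw [hV₂, sum_norm_sq_mul_unitary]; exact h₂
  -- the six terms
  have t1 : ∑ i, ∑ j, ‖((Θ₁ : Matrix α α ℂ) * V₁ * (S₂ * V₂)) i j‖ ^ 2 ≤ e₂ := by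
    have : (Θ₁ : Matrix α α ℂ) * V₁ * (S₂ * V₂) = ((Θ₁ * U₁ : Matrix.unitaryGroup α ℂ) : Matrix α α ℂ) * (S₂ * V₂) := by
      rw [hV₁, Matrix.UnitaryGroup.mul_val]
    rw [this, sum_norm_sq_unitary_mul]; exact hm₂
  have t2 : ∑ i, ∑ j, ‖(S₁ * V₁ * ((Θ₂ : Matrix α α ℂ) * V₂)) i j‖ ^ 2 ≤ e₁ := by
    have : S₁ * V₁ * ((Θ₂ : Matrix α α ℂ) * V₂) = S₁ * V₁ * ((Θ₂ * U₂ : Matrix.unitaryGroup α ℂ) : Matrix α α ℂ) := by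
      rw [hV₂, Matrix.UnitaryGroup.mul_val]
    rw [this, sum_norm_sq_mul_unitary]; exact hm₁
  have t3 : ∑ i, ∑ j, ‖(S₁ * V₁ * (S₂ * V₂)) i j‖ ^ 2 ≤ e₁ := (sum_norm_sq_mul_le_of_opNorm_le_one _ _ hop₂).trans hm₁
  have t4 : ∑ i, ∑ j, ‖((Θ₂ : Matrix α α ℂ) * V₂ * (S₁ * V₁)) i j‖ ^ 2 ≤ e₁ := by
    have : (Θ₂ : Matrix α α ℂ) * V₂ * (S₁ * V₁) = ((Θ₂ * U₂ : Matrix.unitaryGroup α ℂ) : Matrix α α ℂ) * (S₁ * V₁) := by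
      rw [hV₂, Matrix.UnitaryGroup.mul_val]
    rw [this, sum_norm_sq_unitary_mul]; exact hm₁
  have t5 : ∑ i, ∑ j, ‖(S₂ * V₂ * ((Θ₁ : Matrix α α ℂ) * V₁)) i j‖ ^ 2 ≤ e₂ := by
    have : S₂ * V₂ * ((Θ₁ : Matrix α α ℂ) * V₁) = S₂ * V₂ * ((Θ₁ * U₁ : Matrix.unitaryGroup α ℂ) : Matrix α α ℂ) := by
      rw [hV₁, Matrix.UnitaryGroup.mul_val]
    rw [this, sum_norm_sq_mul_unitary]; exact hm₂
  have t6 : ∑ i, ∑ j, ‖(S₂ * V₂ * (S₁ * V₁)) i j‖ ^ 2 ≤ e₂ := (sum_norm_sq_mul_le_of_opNorm_le_one _ _ hop₁).trans hm₂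
  have hA := sum_norm_sq_add_three_le ((Θ₁ : Matrix α α ℂ) * V₁ * (S₂ * V₂)) (S₁ * V₁ * ((Θ₂ : Matrix α α ℂ) * V₂))
    (S₁ * V₁ * (S₂ * V₂))
  have hB := sum_norm_sq_add_three_le ((Θ₂ : Matrix α α ℂ) * V₂ * (S₁ * V₁)) (S₂ * V₂ * ((Θ₁ : Matrix α α ℂ) * V₁))
    (S₂ * V₂ * (S₁ * V₁))
  have hXY := sum_norm_sq_sub_le
    ((Θ₁ : Matrix α α ℂ) * V₁ * (S₂ * V₂) + S₁ * V₁ * ((Θ₂ : Matrix α α ℂ) * V₂) + S₁ * V₁ * (S₂ * V₂))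
    ((Θ₂ : Matrix α α ℂ) * V₂ * (S₁ * V₁) + S₂ * V₂ * ((Θ₁ : Matrix α α ℂ) * V₁) + S₂ * V₂ * (S₁ * V₁))
  nlinarith

/-- **Pair transfer with linear junk** (w4's `haar_prod_robustPairEvent_transfer` under the extra hypotheses `‖S_μ‖_op ≤ 1`):
`Haar²{∃L, rank L ≤ k, Σ|M₁V₁M₂V₂ − M₂V₂M₁V₁ − L|² ≤ s} ≤ Haar²{∃L′, rank L′ ≤ k + 2(q₁+q₂), Σ|P₁P₂ − P₂P₁ − L′|² ≤ 2s + 36(e₁+e₂)}`. -/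
theorem haar_prod_robustPairEvent_transfer_linear (Θ₁ Θ₂ : Matrix.unitaryGroup α ℂ) (R₁ S₁ R₂ S₂ : Matrix α α ℂ)
    {q₁ q₂ k : ℕ} {e₁ e₂ s : ℝ} (hR₁ : R₁.rank ≤ q₁) (hR₂ : R₂.rank ≤ q₂)
    (hS₁ : ∑ i, ∑ j, ‖S₁ i j‖ ^ 2 ≤ e₁) (hS₂ : ∑ i, ∑ j, ‖S₂ i j‖ ^ 2 ≤ e₂) (hS₁' : ‖S₁‖ ≤ 1) (hS₂' : ‖S₂‖ ≤ 1) :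
    (haarα).prod (haarα)
      {V : Matrix.unitaryGroup α ℂ × Matrix.unitaryGroup α ℂ | ∃ L : Matrix α α ℂ, L.rank ≤ k ∧
        ∑ i, ∑ j, ‖(((Θ₁ : Matrix α α ℂ) + R₁ + S₁) * (V.1 : Matrix α α ℂ) *
            (((Θ₂ : Matrix α α ℂ) + R₂ + S₂) * (V.2 : Matrix α α ℂ)) -
          ((Θ₂ : Matrix α α ℂ) + R₂ + S₂) * (V.2 : Matrix α α ℂ) *
            (((Θ₁ : Matrix α α ℂ) + R₁ + S₁) * (V.1 : Matrix α α ℂ)) - L) i j‖ ^ 2 ≤ s} ≤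
    (haarα).prod (haarα)
      {P : Matrix.unitaryGroup α ℂ × Matrix.unitaryGroup α ℂ | ∃ L : Matrix α α ℂ, L.rank ≤ k + 2 * (q₁ + q₂) ∧
        ∑ i, ∑ j, ‖((P.1 : Matrix α α ℂ) * (P.2 : Matrix α α ℂ) - (P.2 : Matrix α α ℂ) * (P.1 : Matrix α α ℂ) - L) i j‖ ^ 2 ≤
          2 * s + 36 * (e₁ + e₂)} := by
  set μ := (haarα).prod (haarα) with hμ
  set Φ := fun p : Matrix.unitaryGroup α ℂ × Matrix.unitaryGroup α ℂ => (Θ₁ * p.1, Θ₂ * p.2) with hΦ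
  have hmp : MeasurePreserving Φ μ μ := measurePreserving_unitary_mul_prod Θ₁ Θ₂
  set E : Set (Matrix.unitaryGroup α ℂ × Matrix.unitaryGroup α ℂ) :=
      {V | ∃ L : Matrix α α ℂ, L.rank ≤ k ∧
        ∑ i, ∑ j, ‖(((Θ₁ : Matrix α α ℂ) + R₁ + S₁) * (V.1 : Matrix α α ℂ) *
            (((Θ₂ : Matrix α α ℂ) + R₂ + S₂) * (V.2 : Matrix α α ℂ)) -
          ((Θ₂ : Matrix α α ℂ) + R₂ + S₂) * (V.2 : Matrix α α ℂ) *
            (((Θ₁ : Matrix α α ℂ) + R₁ + S₁) * (V.1 : Matrix α α ℂ)) - L) i j‖ ^ 2 ≤ s} with hE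
  set F : Set (Matrix.unitaryGroup α ℂ × Matrix.unitaryGroup α ℂ) :=
      {P | ∃ L : Matrix α α ℂ, L.rank ≤ k + 2 * (q₁ + q₂) ∧
        ∑ i, ∑ j, ‖((P.1 : Matrix α α ℂ) * (P.2 : Matrix α α ℂ) - (P.2 : Matrix α α ℂ) * (P.1 : Matrix α α ℂ) - L) i j‖ ^ 2 ≤
          2 * s + 36 * (e₁ + e₂)} with hF
  have hsub : E ⊆ Φ ⁻¹' F := by
    rintro ⟨U₁, U₂⟩ ⟨L, hLk, hLs⟩
    simp only [Set.mem_preimage, hF, Set.mem_setOf_eq, hΦ, Matrix.UnitaryGroup.mul_val]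
    set V₁ : Matrix α α ℂ := (U₁ : Matrix α α ℂ) with hV₁
    set V₂ : Matrix α α ℂ := (U₂ : Matrix α α ℂ) with hV₂
    set Rp : Matrix α α ℂ := R₁ * V₁ * (((Θ₂ : Matrix α α ℂ) + R₂ + S₂) * V₂) +
        ((Θ₁ : Matrix α α ℂ) * V₁ + S₁ * V₁) * (R₂ * V₂) -
        R₂ * V₂ * (((Θ₁ : Matrix α α ℂ) + R₁ + S₁) * V₁) - ((Θ₂ : Matrix α α ℂ) * V₂ + S₂ * V₂) * (R₁ * V₁) with hRp
    set Sp : Matrix α α ℂ := ((Θ₁ : Matrix α α ℂ) * V₁ * (S₂ * V₂) + S₁ * V₁ * ((Θ₂ : Matrix α α ℂ) * V₂) +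
        S₁ * V₁ * (S₂ * V₂)) -
        ((Θ₂ : Matrix α α ℂ) * V₂ * (S₁ * V₁) + S₂ * V₂ * ((Θ₁ : Matrix α α ℂ) * V₁) + S₂ * V₂ * (S₁ * V₁)) with hSp
    have hident := commutator_transfer_identity (Θ₁ : Matrix α α ℂ) R₁ S₁ V₁ (Θ₂ : Matrix α α ℂ) R₂ S₂ V₂
    have hRrank : Rp.rank ≤ 2 * (q₁ + q₂) :=
      (rank_transfer_R_le (Θ₁ : Matrix α α ℂ) R₁ S₁ V₁ (Θ₂ : Matrix α α ℂ) R₂ S₂ V₂).trans (by gcongr)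
    have hSmass : ∑ i, ∑ j, ‖Sp i j‖ ^ 2 ≤ 18 * (e₁ + e₂) :=
      sum_norm_sq_transfer_S_le_linear Θ₁ U₁ Θ₂ U₂ S₁ S₂ hS₁ hS₂ hS₁' hS₂'
    refine ⟨L - Rp, (rank_sub_le _ _).trans (by gcongr), ?_⟩
    have hrew : (Θ₁ : Matrix α α ℂ) * V₁ * ((Θ₂ : Matrix α α ℂ) * V₂) -
        (Θ₂ : Matrix α α ℂ) * V₂ * ((Θ₁ : Matrix α α ℂ) * V₁) - (L - Rp) =
        (((Θ₁ : Matrix α α ℂ) + R₁ + S₁) * V₁ * (((Θ₂ : Matrix α α ℂ) + R₂ + S₂) * V₂) -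
          ((Θ₂ : Matrix α α ℂ) + R₂ + S₂) * V₂ * (((Θ₁ : Matrix α α ℂ) + R₁ + S₁) * V₁) - L) - Sp := by
      rw [hident, hRp, hSp]; abel
    rw [hrew]
    have h2 := sum_norm_sq_sub_le
      (((Θ₁ : Matrix α α ℂ) + R₁ + S₁) * V₁ * (((Θ₂ : Matrix α α ℂ) + R₂ + S₂) * V₂) -
          ((Θ₂ : Matrix α α ℂ) + R₂ + S₂) * V₂ * (((Θ₁ : Matrix α α ℂ) + R₁ + S₁) * V₁) - L) Sp
    linarith
  calc μ E ≤ μ (Φ ⁻¹' F) := measure_mono hsub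
    _ ≤ μ.map Φ F := Measure.le_map_apply hmp.measurable.aemeasurable F
    _ = μ F := by rw [hmp.map_eq]

/-- **THE BLOCK-LOCAL FIBRE BOUND (S10-B).**  For `M_μ = Θ_μ + R_μ + S_μ` as above and phases `|d_i| ≤ 1`, the Haar-pair measure of
«`RIG(M₁V₁) ≤ s₁`, `RIG(M₂V₂) ≤ s₁`, commutator small modulo rank `k` at budget `s`» is at most the MINIMUM of the product of the
two rank-robust rigidity measures and the rank-robust pair measure. -/
theorem blockPairFibre_le_min (Θ₁ Θ₂ : Matrix.unitaryGroup α ℂ) (R₁ S₁ R₂ S₂ : Matrix α α ℂ) (d : α → ℂ) (hd : ∀ i, ‖d i‖ ≤ 1)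
    {q₁ q₂ k : ℕ} {e₁ e₂ s₁ s : ℝ} (hR₁ : R₁.rank ≤ q₁) (hR₂ : R₂.rank ≤ q₂)
    (hS₁ : ∑ i, ∑ j, ‖S₁ i j‖ ^ 2 ≤ e₁) (hS₂ : ∑ i, ∑ j, ‖S₂ i j‖ ^ 2 ≤ e₂) (hS₁' : ‖S₁‖ ≤ 1) (hS₂' : ‖S₂‖ ≤ 1) :
    (haarα).prod (haarα)
      {V : Matrix.unitaryGroup α ℂ × Matrix.unitaryGroup α ℂ |
        ∑ i, ∑ j, ‖d i - d j‖ ^ 2 * ‖(((Θ₁ : Matrix α α ℂ) + R₁ + S₁) * (V.1 : Matrix α α ℂ)) i j‖ ^ 2 ≤ s₁ ∧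
        ∑ i, ∑ j, ‖d i - d j‖ ^ 2 * ‖(((Θ₂ : Matrix α α ℂ) + R₂ + S₂) * (V.2 : Matrix α α ℂ)) i j‖ ^ 2 ≤ s₁ ∧
        ∃ L : Matrix α α ℂ, L.rank ≤ k ∧
          ∑ i, ∑ j, ‖(((Θ₁ : Matrix α α ℂ) + R₁ + S₁) * (V.1 : Matrix α α ℂ) *
              (((Θ₂ : Matrix α α ℂ) + R₂ + S₂) * (V.2 : Matrix α α ℂ)) -
            ((Θ₂ : Matrix α α ℂ) + R₂ + S₂) * (V.2 : Matrix α α ℂ) *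
              (((Θ₁ : Matrix α α ℂ) + R₁ + S₁) * (V.1 : Matrix α α ℂ)) - L) i j‖ ^ 2 ≤ s} ≤
    min
      ((haarα) {V' : Matrix.unitaryGroup α ℂ | ∃ R' : Matrix α α ℂ, R'.rank ≤ 2 * q₁ ∧
          ∑ i, ∑ j, ‖(Matrix.diagonal d * (V' : Matrix α α ℂ) - (V' : Matrix α α ℂ) * Matrix.diagonal d - R') i j‖ ^ 2 ≤
            2 * s₁ + 8 * e₁} *
        (haarα) {V' : Matrix.unitaryGroup α ℂ | ∃ R' : Matrix α α ℂ, R'.rank ≤ 2 * q₂ ∧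
          ∑ i, ∑ j, ‖(Matrix.diagonal d * (V' : Matrix α α ℂ) - (V' : Matrix α α ℂ) * Matrix.diagonal d - R') i j‖ ^ 2 ≤
            2 * s₁ + 8 * e₂})
      ((haarα).prod (haarα)
        {P : Matrix.unitaryGroup α ℂ × Matrix.unitaryGroup α ℂ | ∃ L : Matrix α α ℂ, L.rank ≤ k + 2 * (q₁ + q₂) ∧
          ∑ i, ∑ j, ‖((P.1 : Matrix α α ℂ) * (P.2 : Matrix α α ℂ) - (P.2 : Matrix α α ℂ) * (P.1 : Matrix α α ℂ) - L) i j‖ ^ 2 ≤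
            2 * s + 36 * (e₁ + e₂)}) := by
  refine le_min ?_ ?_
  · -- rigidity branch: the event lies in the product of the two one-link rigidity events
    set A₁ := {V : Matrix.unitaryGroup α ℂ |
        ∑ i, ∑ j, ‖d i - d j‖ ^ 2 * ‖(((Θ₁ : Matrix α α ℂ) + R₁ + S₁) * (V : Matrix α α ℂ)) i j‖ ^ 2 ≤ s₁} with hA₁
    set A₂ := {V : Matrix.unitaryGroup α ℂ |
        ∑ i, ∑ j, ‖d i - d j‖ ^ 2 * ‖(((Θ₂ : Matrix α α ℂ) + R₂ + S₂) * (V : Matrix α α ℂ)) i j‖ ^ 2 ≤ s₁} with hA₂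
    calc (haarα).prod (haarα) _ ≤ (haarα).prod (haarα) (A₁ ×ˢ A₂) := by
          refine measure_mono ?_
          rintro ⟨V₁, V₂⟩ ⟨h1, h2, -⟩
          exact ⟨h1, h2⟩
      _ = (haarα) A₁ * (haarα) A₂ := Measure.prod_prod A₁ A₂
      _ ≤ _ := mul_le_mul (haar_rigidityEvent_le_robust Θ₁ R₁ S₁ d hd hR₁ hS₁)
          (haar_rigidityEvent_le_robust Θ₂ R₂ S₂ d hd hR₂ hS₂) bot_le bot_le
  · -- commutator branch
    calc (haarα).prod (haarα) _ ≤ (haarα).prod (haarα)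
          {V : Matrix.unitaryGroup α ℂ × Matrix.unitaryGroup α ℂ | ∃ L : Matrix α α ℂ, L.rank ≤ k ∧
            ∑ i, ∑ j, ‖(((Θ₁ : Matrix α α ℂ) + R₁ + S₁) * (V.1 : Matrix α α ℂ) *
                (((Θ₂ : Matrix α α ℂ) + R₂ + S₂) * (V.2 : Matrix α α ℂ)) -
              ((Θ₂ : Matrix α α ℂ) + R₂ + S₂) * (V.2 : Matrix α α ℂ) *
                (((Θ₁ : Matrix α α ℂ) + R₁ + S₁) * (V.1 : Matrix α α ℂ)) - L) i j‖ ^ 2 ≤ s} := by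
          refine measure_mono ?_
          rintro V ⟨-, -, h3⟩
          exact h3
      _ ≤ _ := haar_prod_robustPairEvent_transfer_linear Θ₁ Θ₂ R₁ S₁ R₂ S₂ hR₁ hR₂ hS₁ hS₂ hS₁' hS₂'

end Summit.QuantumFields.YangMills.Theorems.EguchiKawaiDirectionLadder

end
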